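import Summits.HubbardSuperconductivity.HubbardSuperconductivity.Theorems.AnisotropyChordTransferFibre3FinNamedSums
import Summits.HubbardSuperconductivity.HubbardSuperconductivity.Theorems.AnisotropyChordTransferFibre3N1RowTrueVec

/-!
# Route `AnisotropyChord` / H0 rotor rung: FIN — the PER-`L` box bridge for the Level-2 variable vector

The Level-2 rows of the GM₃ certificate (p2 `…Fibre3L2Vars`, `…N1RowExpr*`, `…N1RowCheckSound`) are `RExpr` inequalities over the
sixteen-variable vector `L2.point L λ₂ a` (`θ²`, `π²`, `ν = λ₂/θ²`, `a`, and the twelve normalised named one/two-propagator sums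
`θ^{2n}·S₂,S₃,S₄,T10,T11,G21,G12,G22,G31,G13`, `θ⁴·Tx(1,0)`, `θ⁴·Tx(1,1)` of PartN41-B), checked on a `Box` by `decide`.  For `L ≥ L₀` the
box comes from the L-free B1 brackets (`L2.point_mem_box`, `128 ≤ L`).  THIS FILE supplies the same box for ONE FIXED `L` (the FIN range
`L < L₀`), the named sums evaluated EXACTLY at that `L` on the `λ·D`-cell `[la, lb]` by `…Fibre3FinNamedSums`:
* `th2Q`/`th2Iv` (`θ² = (2π/L)²` from `piLo, piHi`), `ivQ`, `nuQ` (the `ν`-interval of a `λ·D`-cell, rounded outward), `namedIvs`,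
  ★ `finBox L la lb a₁ a₂ : Box` — the sixteen intervals as a COMPUTABLE function of `(L, la, lb, a₁, a₂)` (no literals to round-trip;
  all twelve sums ≈ 30 s of kernel time at `L = 31`);
* `ivQ_mem`, `th2Q_mem`, `mem_th2Iv`, `nuQ_mem`, `mem_scaled`,
  ★★ `fin_point_mem_box : 3 ≤ L → denCellPos → λ₂·D ∈ [la, lb] → a ∈ [a₁, a₂] → (finBox L la lb a₁ a₂).mem (L2.point L λ₂ a)`
  (= `L2.point_mem_box` WITHOUT `128 ≤ L`), `finBox_length`, and the prefix-membership form ★ `fin_pmem_xTrue` for p2's true vector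
  `xTrue` (the hypothesis shape of `…N1RowCheckSound.n1CellCheck_sound`, for a checker run on the per-`L` box);
* ★ `finBoxG L la lb` — the same box with the `a`-interval COMPUTED on the cell (g4 `dfnnIv`, regularised `Δ·f_nn`), and
  ★★ `fin_pmem_xTrue_ground`: for the ground profile at `0 ≤ Δ < 1` (`IsGroundTwoMagnon`, `5 ≤ L`, g4 `groundCellCheck`),
  `PMem (finBoxG L la lb) (xTrue L Δ λ₂ f (Δ·f(x̂)))` — per-`L` cells are one-dimensional in `λ`.
Prover seat `hubbard-h0-rotor-p3` g5; helper for piece A = stmt-HubbardSuperconductivity-23918 of rung 19089 (`--supports`, helper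
class).  WHAT THIS IS NOT: nothing here proves superconductivity in the Hubbard model (rotor TARGET as worded stays FALSE, g15 verdict);
evaluator infrastructure for the FIN certificates of ONE conditional reduction.  Tree imports only; no sorry, no new axioms.
-/

set_option linter.dupNamespace false
set_option autoImplicit false

namespace Summit.HubbardSuperconductivity.HubbardSuperconductivity.Theorems.AnisotropyChord.Transfer.Fibre3

namespace FinCell

open scoped BigOperators
open Finset Hole2 Literature.Analysis.ValidatedNumerics

/-! ## `θ²`, `ν`, and the box (computable, zero data) -/

/-- rational enclosure of `θ² = (2π/L)²` from the 20-digit `π` brackets. [folklore] -/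
def th2Q (L : ℕ) : ℚ × ℚ := (4 * piLo ^ 2 / ((L : ℚ) ^ 2), 4 * piHi ^ 2 / ((L : ℚ) ^ 2))

/-- fixed-point enclosure of `θ²` (outward rounding of `th2Q`). [folklore] -/
def th2Iv (L : ℕ) : Iv := (⌊(th2Q L).1 * (D : ℚ)⌋, ⌈(th2Q L).2 * (D : ℚ)⌉)

/-- a fixed-point interval read as a pair of rationals. [folklore] -/
def ivQ (I : Iv) : ℚ × ℚ := (((I.1 : ℤ) : ℚ) / (D : ℚ), ((I.2 : ℤ) : ℚ) / (D : ℚ))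

/-- the `ν = λ/θ²` interval of the `λ·D`-cell `[la, lb]` (outward: divide by the far end of `θ²` according to sign). [folklore] -/
def nuQ (L : ℕ) (la lb : ℤ) : ℚ × ℚ :=
  ((if 0 ≤ la then ((la : ℤ) : ℚ) / ((D : ℚ) * (th2Q L).2) else ((la : ℤ) : ℚ) / ((D : ℚ) * (th2Q L).1)),
   (if 0 ≤ lb then ((lb : ℤ) : ℚ) / ((D : ℚ) * (th2Q L).1) else ((lb : ℤ) : ℚ) / ((D : ℚ) * (th2Q L).2)))

/-- the twelve normalised named sums on the cell, in the order of `L2.point` indices `4 … 15`: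
`θ⁴S₂, θ⁶S₃, θ⁸S₄, θ⁴T10, θ⁴T11, θ⁶G21, θ⁶G12, θ⁸G22, θ⁸G31, θ⁸G13, θ⁴Tx(1,0), θ⁴Tx(1,1)`. [folklore] -/
def namedIvs (L : ℕ) (gt : List (List Iv)) (ct2 : List Iv) : List Iv :=
  [imul (ipow (th2Iv L) 2) (torSumIv L gt ![((0 : ℤ), (0 : ℤ))] ![2]),
   imul (ipow (th2Iv L) 3) (torSumIv L gt ![((0 : ℤ), (0 : ℤ))] ![3]),
   imul (ipow (th2Iv L) 4) (torSumIv L gt ![((0 : ℤ), (0 : ℤ))] ![4]),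
   imul (ipow (th2Iv L) 2) (torSumIv L gt ![((0 : ℤ), (0 : ℤ)), (1, 0)] ![1, 1]),
   imul (ipow (th2Iv L) 2) (torSumIv L gt ![((0 : ℤ), (0 : ℤ)), (1, 1)] ![1, 1]),
   imul (ipow (th2Iv L) 3) (torSumIv L gt ![((0 : ℤ), (0 : ℤ)), (1, 0)] ![2, 1]),
   imul (ipow (th2Iv L) 3) (torSumIv L gt ![((0 : ℤ), (0 : ℤ)), (1, 0)] ![1, 2]),
   imul (ipow (th2Iv L) 4) (torSumIv L gt ![((0 : ℤ), (0 : ℤ)), (1, 0)] ![2, 2]),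
   imul (ipow (th2Iv L) 4) (torSumIv L gt ![((0 : ℤ), (0 : ℤ)), (1, 0)] ![3, 1]),
   imul (ipow (th2Iv L) 4) (torSumIv L gt ![((0 : ℤ), (0 : ℤ)), (1, 0)] ![1, 3]),
   imul (ipow (th2Iv L) 2) (txSumIv L gt ct2 ((1 : ℤ), (0 : ℤ))),
   imul (ipow (th2Iv L) 2) (txSumIv L gt ct2 ((1 : ℤ), (1 : ℤ)))]

/-- ★ THE PER-`L` CELL BOX over the sixteen Level-2 variables (`a ∈ [a₁, a₂]` supplied by the caller), for the `λ·D`-cell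
`[la, lb]`: a computable function, evaluated by the kernel inside any `decide` that consumes it. [folklore] -/
def finBox (L : ℕ) (la lb : ℤ) (a1 a2 : ℚ) : Box :=
  let N := namedIvs L (gresCellTab L (cosTab L) la lb) (cosTab (2 * L))
  [th2Q L, L2.pi2Box, nuQ L la lb, (a1, a2),
    ivQ (N.getD 0 (0, 0)), ivQ (N.getD 1 (0, 0)), ivQ (N.getD 2 (0, 0)), ivQ (N.getD 3 (0, 0)),
    ivQ (N.getD 4 (0, 0)), ivQ (N.getD 5 (0, 0)), ivQ (N.getD 6 (0, 0)), ivQ (N.getD 7 (0, 0)),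
    ivQ (N.getD 8 (0, 0)), ivQ (N.getD 9 (0, 0)), ivQ (N.getD 10 (0, 0)), ivQ (N.getD 11 (0, 0))]

/-- ★ the per-`L` cell box of the GROUND profile: the `a`-interval is COMPUTED on the cell from g4's regularised closed form
`Δ·f_nn = (4 − 4VλG₀)/(4w)` (`…FinGroundCell.dfnnIv`), so per-`L` cells are one-dimensional (in `λ`). [folklore] -/
def finBoxG (L : ℕ) (la lb : ℤ) : Box :=
  finBox L la lb (ivQ (dfnnIv L la lb)).1 (ivQ (dfnnIv L la lb)).2

/-! ## Soundness -/

/-- the rational reading of an enclosure. [folklore] -/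
theorem ivQ_mem {x : ℝ} {I : Iv} (hx : mem x I) : (((ivQ I).1 : ℚ) : ℝ) ≤ x ∧ x ≤ (((ivQ I).2 : ℚ) : ℝ) := by
  obtain ⟨h1, h2⟩ := hx
  have hD := D_pos
  unfold ivQ
  push_cast
  constructor
  · rw [div_le_iff₀ hD]; exact h1
  · rw [le_div_iff₀ hD]; exact h2

/-- `θ² ∈ [4·piLo²/L², 4·piHi²/L²]`. [folklore] -/
theorem th2Q_mem (L : ℕ) [NeZero L] :
    (((th2Q L).1 : ℚ) : ℝ) ≤ (2 * Real.pi / L) ^ 2 ∧ (2 * Real.pi / L) ^ 2 ≤ (((th2Q L).2 : ℚ) : ℝ) := by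
  obtain ⟨h1, h2⟩ := pi_mem
  have hL : (0 : ℝ) < L := by exact_mod_cast Nat.pos_of_ne_zero (NeZero.ne L)
  have h0 : (0 : ℝ) ≤ ((piLo : ℚ) : ℝ) := by unfold piLo; push_cast; norm_num
  unfold th2Q
  push_cast
  rw [div_pow, mul_pow]
  have hL2 : (0 : ℝ) < (L : ℝ) ^ 2 := by positivity
  constructor
  · rw [div_le_div_iff_of_pos_right hL2]
    nlinarith [pow_le_pow_left₀ h0 h1.le 2]
  · rw [div_le_div_iff_of_pos_right hL2]
    nlinarith [pow_le_pow_left₀ Real.pi_pos.le h2.le 2]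

/-- `0 < 4·piLo²/L²`. [folklore] -/
theorem th2Q_fst_pos (L : ℕ) [NeZero L] : (0 : ℝ) < (((th2Q L).1 : ℚ) : ℝ) := by
  have hL : (0 : ℝ) < L := by exact_mod_cast Nat.pos_of_ne_zero (NeZero.ne L)
  unfold th2Q piLo
  push_cast
  positivity

/-- `θ² ∈ th2Iv L`. [folklore] -/
theorem mem_th2Iv (L : ℕ) [NeZero L] : mem ((2 * Real.pi / L) ^ 2) (th2Iv L) := by
  obtain ⟨h1, h2⟩ := th2Q_mem L
  have hD := D_pos
  have hf : ((⌊(th2Q L).1 * (D : ℚ)⌋ : ℤ) : ℝ) ≤ (((th2Q L).1 * (D : ℚ) : ℚ) : ℝ) := by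
    exact_mod_cast Int.floor_le ((th2Q L).1 * (D : ℚ))
  have hc : ((((th2Q L).2 * (D : ℚ) : ℚ)) : ℝ) ≤ ((⌈(th2Q L).2 * (D : ℚ)⌉ : ℤ) : ℝ) := by
    exact_mod_cast Int.le_ceil ((th2Q L).2 * (D : ℚ))
  push_cast at hf hc
  unfold th2Iv mem
  dsimp only
  constructor
  · nlinarith
  · nlinarith

/-- the `ν`-interval of a `λ·D`-cell contains `λ/θ²`. [folklore] -/
theorem nuQ_mem (L : ℕ) [NeZero L] {lam : ℝ} {la lb : ℤ}
    (hla : (la : ℝ) ≤ lam * ((D : ℤ) : ℝ)) (hlb : lam * ((D : ℤ) : ℝ) ≤ (lb : ℝ)) :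
    (((nuQ L la lb).1 : ℚ) : ℝ) ≤ lam / (2 * Real.pi / L) ^ 2 ∧ lam / (2 * Real.pi / L) ^ 2 ≤ (((nuQ L la lb).2 : ℚ) : ℝ) := by
  obtain ⟨ht1, ht2⟩ := th2Q_mem L
  have htpos := th2Q_fst_pos L
  have hD := D_pos
  have ht0 : 0 < (2 * Real.pi / L) ^ 2 := lt_of_lt_of_le htpos ht1
  have hthi0 : (0 : ℝ) < (((th2Q L).2 : ℚ) : ℝ) := lt_of_lt_of_le ht0 ht2
  have hlamlo : (la : ℝ) / ((D : ℤ) : ℝ) ≤ lam := by rw [div_le_iff₀ hD]; exact hla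
  have hlamhi : lam ≤ (lb : ℝ) / ((D : ℤ) : ℝ) := by rw [le_div_iff₀ hD]; exact hlb
  unfold nuQ
  constructor
  · by_cases h0 : 0 ≤ la
    · rw [if_pos h0]
      push_cast
      have hla0 : (0 : ℝ) ≤ (la : ℝ) / ((D : ℤ) : ℝ) := by
        have : (0 : ℝ) ≤ (la : ℝ) := by exact_mod_cast h0
        positivity
      calc ((la : ℤ) : ℝ) / (((D : ℤ) : ℝ) * (((th2Q L).2 : ℚ) : ℝ))
          = ((la : ℝ) / ((D : ℤ) : ℝ)) / (((th2Q L).2 : ℚ) : ℝ) := by rw [div_div]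
        _ ≤ ((la : ℝ) / ((D : ℤ) : ℝ)) / (2 * Real.pi / L) ^ 2 := div_le_div_of_nonneg_left hla0 ht0 ht2
        _ ≤ lam / (2 * Real.pi / L) ^ 2 := div_le_div_of_nonneg_right hlamlo ht0.le
    · rw [if_neg h0]
      push_cast
      have hla0 : (la : ℝ) / ((D : ℤ) : ℝ) < 0 := by
        have : (la : ℝ) < 0 := by exact_mod_cast (not_le.mp h0)
        exact div_neg_of_neg_of_pos this hD
      calc ((la : ℤ) : ℝ) / (((D : ℤ) : ℝ) * (((th2Q L).1 : ℚ) : ℝ))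
          = ((la : ℝ) / ((D : ℤ) : ℝ)) / (((th2Q L).1 : ℚ) : ℝ) := by rw [div_div]
        _ ≤ ((la : ℝ) / ((D : ℤ) : ℝ)) / (2 * Real.pi / L) ^ 2 := by
            rw [div_le_div_iff₀ htpos ht0]
            nlinarith
        _ ≤ lam / (2 * Real.pi / L) ^ 2 := div_le_div_of_nonneg_right hlamlo ht0.le
  · by_cases h0 : 0 ≤ lb
    · rw [if_pos h0]
      push_cast
      have hlb0 : (0 : ℝ) ≤ (lb : ℝ) / ((D : ℤ) : ℝ) := by
        have : (0 : ℝ) ≤ (lb : ℝ) := by exact_mod_cast h0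
        positivity
      calc lam / (2 * Real.pi / L) ^ 2
          ≤ ((lb : ℝ) / ((D : ℤ) : ℝ)) / (2 * Real.pi / L) ^ 2 := div_le_div_of_nonneg_right hlamhi ht0.le
        _ ≤ ((lb : ℝ) / ((D : ℤ) : ℝ)) / (((th2Q L).1 : ℚ) : ℝ) := div_le_div_of_nonneg_left hlb0 htpos ht1
        _ = ((lb : ℤ) : ℝ) / (((D : ℤ) : ℝ) * (((th2Q L).1 : ℚ) : ℝ)) := by rw [div_div]
    · rw [if_neg h0]
      push_cast
      have hlb0 : (lb : ℝ) / ((D : ℤ) : ℝ) < 0 := by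
        have : (lb : ℝ) < 0 := by exact_mod_cast (not_le.mp h0)
        exact div_neg_of_neg_of_pos this hD
      calc lam / (2 * Real.pi / L) ^ 2
          ≤ ((lb : ℝ) / ((D : ℤ) : ℝ)) / (2 * Real.pi / L) ^ 2 := div_le_div_of_nonneg_right hlamhi ht0.le
        _ ≤ ((lb : ℝ) / ((D : ℤ) : ℝ)) / (((th2Q L).2 : ℚ) : ℝ) := by
            rw [div_le_div_iff₀ ht0 hthi0]
            nlinarith
        _ = ((lb : ℤ) : ℝ) / (((D : ℤ) : ℝ) * (((th2Q L).2 : ℚ) : ℝ)) := by rw [div_div]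

/-- a scaled named sum: `mem (θ^{2n}·X) (imul (ipow th2Iv n) I)` from `mem X I`. [folklore] -/
theorem mem_scaled (L : ℕ) [NeZero L] {x : ℝ} {I : Iv} (hx : mem x I) (n : ℕ) :
    mem ((2 * Real.pi / L) ^ (2 * n) * x) (imul (ipow (th2Iv L) n) I) := by
  rw [pow_mul]
  exact mem_imul (mem_ipow (mem_th2Iv L) n) hx

/-- ★★ **THE PER-`L` BOX BRIDGE**: at fixed `L ≥ 3`, for every `λ₂` in the `λ·D`-cell `[la, lb]` passing the positivity check and every
`a ∈ [a₁, a₂]`, the box `finBox L la lb a₁ a₂` contains the Level-2 variable vector `L2.point L λ₂ a` — `L2.point_mem_box`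
without `128 ≤ L`, the twelve named sums evaluated exactly at this `L`. [folklore] -/
theorem fin_point_mem_box (L : ℕ) [NeZero L] (hL : 3 ≤ L) {la lb : ℤ} (hpos : denCellPos L (cosTab L) la lb = true)
    (a1 a2 : ℚ) (lam2 a : ℝ) (hla : (la : ℝ) ≤ lam2 * ((D : ℤ) : ℝ)) (hlb : lam2 * ((D : ℤ) : ℝ) ≤ (lb : ℝ))
    (ha1 : ((a1 : ℚ) : ℝ) ≤ a) (ha2 : a ≤ ((a2 : ℚ) : ℝ)) :
    (finBox L la lb a1 a2).mem (L2.point L lam2 a) := by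
  have hθ := th2Q_mem L
  have hπ := L2.pi_sq_mem
  have hν := nuQ_mem L hla hlb
  have hT := fun {m : ℕ} (s : Fin m → ℤ × ℤ) (ex : Fin m → ℕ) => mem_torSum_cell L hL hla hlb hpos s ex
  have hX := fun (q : ℤ × ℤ) => mem_txSum_cell L hL hla hlb hpos q
  have e4 := ivQ_mem (mem_scaled L (hT ![((0 : ℤ), (0 : ℤ))] ![2]) 2)
  have e5 := ivQ_mem (mem_scaled L (hT ![((0 : ℤ), (0 : ℤ))] ![3]) 3)
  have e6 := ivQ_mem (mem_scaled L (hT ![((0 : ℤ), (0 : ℤ))] ![4]) 4)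
  have e7 := ivQ_mem (mem_scaled L (hT ![((0 : ℤ), (0 : ℤ)), (1, 0)] ![1, 1]) 2)
  have e8 := ivQ_mem (mem_scaled L (hT ![((0 : ℤ), (0 : ℤ)), (1, 1)] ![1, 1]) 2)
  have e9 := ivQ_mem (mem_scaled L (hT ![((0 : ℤ), (0 : ℤ)), (1, 0)] ![2, 1]) 3)
  have e10 := ivQ_mem (mem_scaled L (hT ![((0 : ℤ), (0 : ℤ)), (1, 0)] ![1, 2]) 3)
  have e11 := ivQ_mem (mem_scaled L (hT ![((0 : ℤ), (0 : ℤ)), (1, 0)] ![2, 2]) 4)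
  have e12 := ivQ_mem (mem_scaled L (hT ![((0 : ℤ), (0 : ℤ)), (1, 0)] ![3, 1]) 4)
  have e13 := ivQ_mem (mem_scaled L (hT ![((0 : ℤ), (0 : ℤ)), (1, 0)] ![1, 3]) 4)
  have e14 := ivQ_mem (mem_scaled L (hX ((1 : ℤ), (0 : ℤ))) 2)
  have e15 := ivQ_mem (mem_scaled L (hX ((1 : ℤ), (1 : ℤ))) 2)
  intro i
  unfold finBox Box.ivl
  match i with
  | 0 => simpa [L2.point] using hθ
  | 1 => simpa [L2.point, L2.pi2Box] using hπ
  | 2 => simpa [L2.point] using hν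
  | 3 => simpa [L2.point] using ⟨ha1, ha2⟩
  | 4 => simpa [L2.point, S2n, namedIvs] using e4
  | 5 => simpa [L2.point, S3n, namedIvs] using e5
  | 6 => simpa [L2.point, S4n, namedIvs] using e6
  | 7 => simpa [L2.point, T10n, namedIvs] using e7
  | 8 => simpa [L2.point, T11n, namedIvs] using e8
  | 9 => simpa [L2.point, G21n, namedIvs] using e9
  | 10 => simpa [L2.point, G12n, namedIvs] using e10
  | 11 => simpa [L2.point, G22n, namedIvs] using e11
  | 12 => simpa [L2.point, G31n, namedIvs] using e12
  | 13 => simpa [L2.point, G13n, namedIvs] using e13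
  | 14 => simpa [L2.point, namedIvs] using e14
  | 15 => simpa [L2.point, namedIvs] using e15
  | n + 16 => simp [L2.point]

/-- the per-`L` box has the sixteen base coordinates. [folklore] -/
theorem finBox_length (L : ℕ) (la lb : ℤ) (a1 a2 : ℚ) : (finBox L la lb a1 a2).length = 16 := by
  simp [finBox]

/-- ★ prefix-membership form for p2's true vector: `PMem (finBox L la lb a₁ a₂) (xTrue L Δ λ₂ f a)` at fixed `L ≥ 3` — the hypothesis
of `…N1RowCheckSound` for a checker run on the per-`L` box. [folklore] -/
theorem fin_pmem_xTrue (L : ℕ) [NeZero L] (hL : 3 ≤ L) {la lb : ℤ} (hpos : denCellPos L (cosTab L) la lb = true)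
    (a1 a2 : ℚ) (Δ lam2 : ℝ) (f : Tor L → ℝ) (a : ℝ)
    (hla : (la : ℝ) ≤ lam2 * ((D : ℤ) : ℝ)) (hlb : lam2 * ((D : ℤ) : ℝ) ≤ (lb : ℝ))
    (ha1 : ((a1 : ℚ) : ℝ) ≤ a) (ha2 : a ≤ ((a2 : ℚ) : ℝ)) :
    L2.N1.PMem (finBox L la lb a1 a2) (L2.N1.xTrue L Δ lam2 f a) := by
  intro i hi
  rw [finBox_length] at hi
  have hm := fin_point_mem_box L hL hpos a1 a2 lam2 a hla hlb ha1 ha2 i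
  rw [L2.N1.xTrue_lt16 L Δ lam2 f a hi]
  exact hm

/-- the ground-profile box has the sixteen base coordinates. [folklore] -/
theorem finBoxG_length (L : ℕ) (la lb : ℤ) : (finBoxG L la lb).length = 16 := finBox_length L la lb _ _

/-- ★★ THE GROUND-PROFILE FORM: at fixed `L ≥ 5`, for the ground two-magnon profile `(λ₂, f)` at `0 ≤ Δ < 1` with `λ₂·D` in a
cell passing g4's `groundCellCheck`, p2's true vector at `a = Δ·f(x̂)` is a prefix-member of `finBoxG L la lb` — the `a`-interval
comes from the cell itself (`mem_deltaMulFnn_cell`, p1 `ground_delta_eq` / `ground_fnn_eq_explicit`). [folklore] -/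
theorem fin_pmem_xTrue_ground (L : ℕ) [NeZero L] (hL : 5 ≤ L) {Δ lam2 : ℝ} (hΔ0 : 0 ≤ Δ) (hΔ1 : Δ < 1) {f : Tor L → ℝ}
    (hf : IsGroundTwoMagnon L Δ lam2 f) (hlam : 0 < lam2) {la lb : ℤ}
    (hla : (la : ℝ) ≤ lam2 * ((D : ℤ) : ℝ)) (hlb : lam2 * ((D : ℤ) : ℝ) ≤ (lb : ℝ)) (hchk : groundCellCheck L la lb = true) :
    L2.N1.PMem (finBoxG L la lb) (L2.N1.xTrue L Δ lam2 f (Δ * f (K1 L))) := by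
  obtain ⟨hpos, _, _⟩ := groundCellCheck_spec hchk
  have hm := mem_deltaMulFnn_cell L (by omega) hlam hla hlb hchk
  rw [← ground_delta_eq L hL hΔ0 hΔ1 hf, ← ground_fnn_eq_explicit L hL hΔ0 hΔ1 hf] at hm
  obtain ⟨h1, h2⟩ := ivQ_mem hm
  exact fin_pmem_xTrue L (by omega) hpos _ _ Δ lam2 f _ hla hlb h1 h2

end FinCell

end Summit.HubbardSuperconductivity.HubbardSuperconductivity.Theorems.AnisotropyChord.Transfer.Fibre3
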